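import Summits.CriticalPhenomena.SAWScalingLimit.Theorems.SAWTotalPositivityCriticalBubbleBoundJoinMacroDefs

/-!
# Objects of the JOIN-MASS programme, IV: BIG classes and the size hypothesis of the entropy side
(crux `SAWTotalPositivity.CriticalBubbleBound`, stmt-CriticalPhenomena-7117; line `docking-census-joining`,
lead prover c7, crux protocol)

The parametric macroscopic door (`Join.criticalBubbleBound_of_joinEntropyAt_of_joinMacroRarity`: for
`0 ≤ κ`, `κ + π > 2`, `JoinEntropyAt κ → JoinMacroRarity π → CriticalBubbleBound`) has two knobs. The
entropy knob `κ` is Hammond's count of admissible vertical offsets of the Madras join, i.e. the HEIGHT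
of the classes being joined: `κ = 3/2` is proved from the deterministic height `≥ √N` of a tall class
(`Join.Dent_ge`), and any `κ = 1 + ν'` follows as soon as a positive fraction of the critical mass of every
dyadic block is carried by classes of linear size `≥ 2^{ν' i}` (conjecturally true for every `ν' < ν = 3/4`;
open for every `ν' > 1/2` — "critical self-avoiding polygons are not dense"). This file DEFINES that size
hypothesis; no statement of the programme is asserted here.

* `IsBigAt ν' i n χ` — the class `χ` (walk length `n`) has linear size `max (height, width) ≥ 2^{ν' i}`
  (invariant under the quarter-turn and vertical-flip transports of the programme);
* `bigMass ν' i` — the critical mass of the BIG classes of shifted index in block `i` (`≤ blockMass jterm i`);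
* `BigMassFraction ν'` (`@[conjecture]`, obligation node) — for all large `i`, `c · R'_i ≤ bigMass ν' i`:
  a positive fraction of the block's critical mass sits on classes of linear size `≥ 2^{ν' i}`.

Elementary API: `bigMass_nonneg`, `bigMass_le_blockMass` (registered), `BigMassFraction.anti`,
`bigMassFraction_zero` (registered floor: every class has width `≥ 1`, so `ν' = 0` holds with `c = 1`).

Sources: A. Hammond, Ann. Probab. 46 (2018) = arXiv:1808.09032, Lemma 4.11/4.12 (offsets = heights);
N. Madras, G. Slade, *The Self-Avoiding Walk* (1993), §1.1 (the exponent `ν`).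
-/

noncomputable section

open Literature.Probability.LatticeModels
open Literature.Probability.RandomPlanarGeometry Literature.Probability.RandomPlanarGeometry.SAW
open scoped BigOperators
open Summit.CriticalPhenomena.SAWScalingLimit.Theorems.CriticalBubbleBound.Negative (e₀)
open Summit.CriticalPhenomena.SAWScalingLimit.Theorems.CriticalBubbleBound.Docking

namespace Summit.CriticalPhenomena.SAWScalingLimit.Theorems.CriticalBubbleBound.Join

/-! ## Big classes and their mass -/

/-- `χ` (a rooted polygon of walk length `n`) is BIG at exponent `ν'` and scale `i`: its linear size
`max (height, width)` is at least `2^{ν' i}`. [cite: Hammond2015SAPJoining, Lemma 4.11] -/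
def IsBigAt (ν' : ℝ) (i n : ℕ) (χ : ℕ → Site 2) : Prop :=
  (2 : ℝ) ^ (ν' * (i : ℝ)) ≤ ((max (height n χ) (width n χ) : ℤ) : ℝ)

open Classical in
/-- Critical mass of the BIG classes of shifted index in block `i`:
`bigMass ν' i = Σ_{n ∈ B_i, n ≥ 17} #{χ ∈ lexRooted (n-17) : IsBigAt ν' i (n-17) χ} · x_c^{n-17+1}`.
[cite: Hammond2015SAPJoining, Lemma 4.12] -/
def bigMass (ν' : ℝ) (i : ℕ) : ℝ :=
  ∑ n ∈ block i, if joinShift ≤ n then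
    (((lexRooted (n - joinShift)).filter fun χ => IsBigAt ν' i (n - joinShift) χ).card : ℝ) *
      criticalFugacity ^ (n - joinShift + 1) else 0

/-- **Big-mass fraction with exponent `ν'`** (line conjecture of `docking-census-joining`, crux
stmt-CriticalPhenomena-7117; the SIZE input of the entropy knob): for all large `i`, at least a fixed
fraction `c` of the critical mass `R'_i = blockMass jterm i` of the dyadic block is carried by classes
of linear size `max (height, width) ≥ 2^{ν' i}`. Conjecturally true for every `ν' < ν = 3/4` (typical
linear size `≍ N^{3/4}` of a critical planar polygon of length `N`); proved: `ν' = 0` only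
(`bigMassFraction_zero`; even `ν' > 1/2`, non-density of critical polygons, is open). Through
Hammond's offsets count it yields join entropy `κ = 1 + ν'` (`Join.joinEntropyAt_of_bigMassFraction`).
A conjecture of THIS programme in this normalisation, not a result in print. [cite: MadrasSlade1993, §1.1] -/
@[conjecture] def BigMassFraction (ν' : ℝ) : Prop :=
  ∃ c : ℝ, 0 < c ∧ ∃ i₀ : ℕ, ∀ i : ℕ, i₀ ≤ i → c * blockMass jterm i ≤ bigMass ν' i

/-! ## Elementary API -/

/-- `IsBigAt` is antitone in the exponent. [folklore] -/
theorem IsBigAt.anti {ν' ν'' : ℝ} {i n : ℕ} {χ : ℕ → Site 2} (h : IsBigAt ν' i n χ) (hle : ν'' ≤ ν') :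
    IsBigAt ν'' i n χ := by
  unfold IsBigAt at h ⊢
  refine le_trans ?_ h
  exact Real.rpow_le_rpow_of_exponent_le (by norm_num)
    (mul_le_mul_of_nonneg_right hle (Nat.cast_nonneg i))

/-- The big masses are nonnegative. [folklore] -/
theorem bigMass_nonneg (ν' : ℝ) (i : ℕ) : 0 ≤ bigMass ν' i := by
  refine Finset.sum_nonneg fun n _ => ?_
  split_ifs
  · exact mul_nonneg (Nat.cast_nonneg _) (pow_nonneg criticalFugacity_pos_lt_one'.1.le _)
  · exact le_rfl

/-- The big mass is at most the block mass: `bigMass ν' i ≤ R'_i` (registered infrastructure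
sub-goal; termwise `#filter ≤ #lexRooted` and `jterm n = cterm (n - 17)` above the shift). [folklore] -/
theorem bigMass_le_blockMass : ∀ (ν' : ℝ) (i : ℕ), bigMass ν' i ≤ blockMass jterm i := by
  intro ν' i
  classical
  rw [blockMass, bigMass]
  refine Finset.sum_le_sum fun n _ => ?_
  split_ifs with h
  · rw [jterm_of_le h, cterm]
    exact mul_le_mul_of_nonneg_right (by exact_mod_cast Finset.card_le_card (Finset.filter_subset _ _))
      (pow_nonneg criticalFugacity_pos_lt_one'.1.le _)
  · rw [jterm_of_lt (not_le.1 h)]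

/-- `bigMass` is antitone in the exponent. [folklore] -/
theorem bigMass_anti {ν' ν'' : ℝ} (hle : ν'' ≤ ν') (i : ℕ) : bigMass ν' i ≤ bigMass ν'' i := by
  classical
  refine Finset.sum_le_sum fun n _ => ?_
  split_ifs
  · refine mul_le_mul_of_nonneg_right ?_ (pow_nonneg criticalFugacity_pos_lt_one'.1.le _)
    refine Nat.cast_le.2 (Finset.card_le_card fun χ hχ => ?_)
    rw [Finset.mem_filter] at hχ ⊢
    exact ⟨hχ.1, hχ.2.anti hle⟩
  · exact le_rfl

/-- `BigMassFraction` is antitone in the exponent. [folklore] -/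
theorem BigMassFraction.anti {ν' ν'' : ℝ} (h : BigMassFraction ν') (hle : ν'' ≤ ν') :
    BigMassFraction ν'' := by
  obtain ⟨c, hc, i₀, h⟩ := h
  exact ⟨c, hc, i₀, fun i hi => le_trans (h i hi) (bigMass_anti hle i)⟩

/-- Every lex-rooted class has width at least `1` (its root edge is `{0, e₀}`). [folklore] -/
theorem one_le_width_of_mem_lexRooted {n : ℕ} {χ : ℕ → Site 2} (h : χ ∈ lexRooted n) : 1 ≤ width n χ := by
  have hsaw := lexRooted_subset n h
  have h0 : χ 0 = 0 := (Zd.mem_sawFun.1 hsaw).1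
  have hn : χ n = e₀ := (Zd.mem_sawFun.1 hsaw).2.1 n le_rfl
  have h1 : xmin n χ ≤ χ 0 0 := xmin_le_apply χ (Nat.zero_le n)
  have h2 : χ n 0 ≤ xmax n χ := apply_le_xmax χ le_rfl
  have he : e₀ 0 = 1 := rfl
  rw [h0, Pi.zero_apply] at h1
  rw [hn, he] at h2
  simp only [width]
  omega

/-- The floor `ν' = 0`: every class is big at threshold `2^0 = 1` (width `≥ 1`), so `bigMass 0 i = R'_i`
and `BigMassFraction 0` holds with `c = 1` (registered floor). [folklore] -/
theorem bigMassFraction_zero : BigMassFraction 0 := by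
  classical
  refine ⟨1, one_pos, 0, fun i _ => ?_⟩
  rw [one_mul, blockMass, bigMass]
  refine Finset.sum_le_sum fun n _ => ?_
  split_ifs with h
  · rw [jterm_of_le h, cterm]
    refine mul_le_mul_of_nonneg_right ?_ (pow_nonneg criticalFugacity_pos_lt_one'.1.le _)
    have : (lexRooted (n - joinShift)).filter (fun χ => IsBigAt 0 i (n - joinShift) χ) =
        lexRooted (n - joinShift) := by
      refine Finset.filter_true_of_mem fun χ hχ => ?_
      unfold IsBigAt
      rw [zero_mul, Real.rpow_zero]
      have h1 := one_le_width_of_mem_lexRooted hχ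
      have : (1 : ℤ) ≤ max (height (n - joinShift) χ) (width (n - joinShift) χ) := le_trans h1 (le_max_right _ _)
      exact_mod_cast this
    rw [this]
  · rw [jterm_of_lt (not_le.1 h)]

end Summit.CriticalPhenomena.SAWScalingLimit.Theorems.CriticalBubbleBound.Join

end
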